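import Summits.CriticalPhenomena.Ising3DConformalLimit.Theorems.SynchronousCouplingDefs
import Summits.CriticalPhenomena.Ising3DConformalLimit.Theorems.HyperoctahedralRPExistsScaleCovariantLimitBlockDefs

/-!
# Route `SynchronousCoupling`, crux `RotationJoining` (stmt-CriticalPhenomena-18763), line `SketchIdeator2` —
# definitions module of RESHAPE 2 ("tilted joinings and FDD isotropy from the route's own cruxes")

Second DEFINITIONS module of the line (the first is `Theorems/SynchronousCouplingDefs.lean`, p158142/p160328, whose
vocabulary `A3`, `axisCell`, `tiltCell`, `blockSum`, `normAxis`, `normTilt`, `DilationJoiningsAxis3`,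
`DilationJoiningsTilted`, `AsymptoticFDDIsotropy`, … is reused verbatim). Nothing is asserted here: every `def … : Prop`
below is a STATEMENT, proved by a registered stub file `Theorems/SynchronousCouplingRotationJoining<Stub>.lean` or used as
an explicit hypothesis; the only non-`Prop` definitions are Kozma's commensurate-rotation map `psi` (`ψ(x) = ⌊A x / 3⌋`)
and its inverse `psiInv` (G. Kozma, *The scaling limit of loop-erased random walk in three dimensions*, Acta Math. 199
(2007), §6.1: the lattice `Aℤ³`, `A = 3T`, meets every aligned `3`-cell of `ℤ³` in exactly one point, so `ψ` is a
bijection of `ℤ³` within sup-distance `< 1` of the rotation `T = A/3`; formalised in the crux disprover's `Disproof.lean`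
§7, from which the two formulas are copied).

## The reshape (lead `prover-line-stmt-CriticalPhenomena-18763-c1-0`, 2026-08-17)

Reshape 1 (lead 0) closed the crux MODULO three open statements: `DilationJoiningsAxis3` (⇐ item 18762 by the landed
`stub_axis3OfDilationJoinings`), `DilationJoiningsTilted` and `AsymptoticFDDIsotropy`. Reshape 2 derives the last two
from the route's own open cruxes `DilationJoinings` (stmt-18762) and `UniformRegularity` (stmt-4658) — both ALREADY
hypotheses of the route's deciding theorem `closes` — through the tree's scaling-limit funnel
`DilationJoinings ∧ UniformRegularity ⇒ BlockLimits ⇒ pinned pointwise limit S` (`Cruxes.JoiningsTransfer.Sketch`, p-landed)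
and the tree's rotation theorem `LimitRotationInvariant_of HRP2Rigidity_of` (items 1980/1979):

* `DilationJoiningsTilted ⇐ DilationJoinings`: the SAME coupling works — read a tilted cell of side `b` (resp. `3b`) as
  the exact disjoint union of the axis cells of side `b'` (resp. `3b'`, same indices) it contains plus a boundary layer
  of `≤ 30 b² b'` points (`TiltGeometry`), apply the dilation joining at the finer pair of scales `(3b', b')` block by
  block (Minkowski in `L²` of the coupling), and control the boundary layers and the normaliser mismatch by two-point
  sums (`BallSums`, in tree, and the super-cubic growth `V(ℓ) ≤ A (ℓ/L)^{7/2} V(L)` of the block variance,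
  `TwoPointToolkit`, from `TwoPointScaling`); `b' ≈ b^{1-δ}` with `δ` small against the dilation rate gives a power rate
  (`TiltedTransfer`).
* `AsymptoticFDDIsotropy ⇐ DilationJoinings ∧ UniformRegularity`: every tilted cell is the `ψ⁻¹`-image of its axis
  cell, so a mixed moment of tilted blocks is the sum of `⟨∏σ_{ψ⁻¹ yᵢ}⟩` over the AXIS cells; far from the diagonals
  `ρ(1/n)^k ⟨∏σ_{ψ⁻¹yᵢ}⟩ ≈ S_k(ψ⁻¹y/n) ≈ S_k(T⁻¹(y/n)) = S_k(y/n) ≈ ρ(1/n)^k⟨∏σ_{yᵢ}⟩` termwise (locally uniform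
  convergence to the pinned limit `S`, continuity of `S_k` off the diagonals, `IsRotationInvariant S`); near the diagonals
  both sums are uniformly small (Newman's Gaussian bound `NewmanBlocks`, `BallSums`, `TwoPointToolkit`); so all normalised
  mixed moments of the tilted and of the axis block vectors are asymptotically equal, and sub-Gaussian moment bounds turn
  this into asymptotic equality of the laws against bounded continuous tests (`MomentsToTests`: tightness, Prokhorov,
  Lévy's uniqueness via characteristic functions) (`IsotropyTransfer`).

So the crux closes MODULO `RouteCruxes := DilationJoinings ∧ UniformRegularity` (items 18762 ∧ 4658 verbatim).

## Contents
`psi`, `psiInv`; the statements `TwoPointToolkit`, `BallSums`, `TiltGeometry`, `NewmanBlocks`, `MomentsToTests`,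
`TiltedTransfer`, `IsotropyTransfer`, `RouteCruxes`; the registered stub statements `Sig.stub_*` of reshape 2.
Sources: Kozma 2007 §6.1; C. M. Newman, Z. Wahrsch. 33 (1975) 75–93 (Gaussian inequality); M. Aizenman,
H. Duminil-Copin, Ann. Math. 194 (2021) §6; P. Billingsley, *Convergence of Probability Measures* (2nd ed. 1999),
Thm 5.1 / §30 (method of moments, tightness); A. Messager, S. Miracle-Solé, J. Stat. Phys. 17 (1977).
-/

noncomputable section

namespace Summit.CriticalPhenomena.Ising3DConformalLimit.Cruxes.RotationJoining.RateSplitting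

open MeasureTheory Filter Literature.Probability.LatticeModels
open scoped Topology BigOperators
open Summit.CriticalPhenomena.Ising3DConformalLimit.Cruxes.ExistsScaleCovariantLimit.MonotoneBlockingPort (blockCov)
open Summit.CriticalPhenomena.Ising3DConformalLimit.Theses

/-! ## Kozma's commensurate-rotation bijection `ψ = ⌊A·/3⌋` of `ℤ³` -/

/-- Kozma's device `ψ(x) = ⌊A x / 3⌋` (coordinatewise integer division; `A = A3 = 3T`). It is a bijection of `ℤ³`
with `|3ψ(x)ᵢ − (Ax)ᵢ| ≤ 2`, and `x ∈ tiltCell n m u ↔ ψ x ∈ axisCell n u` for `|uᵢ| ≤ m` (`TiltGeometry`). -/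
def psi (x : Site 3) : Site 3 := fun i => A3.mulVec x i / 3

/-- The inverse bijection `ψ⁻¹(w) = (Aᵀ w + r(w)·(1,1,1)) / 3`, `r(w) = (w₀ + w₁ + w₂) mod 3`. -/
def psiInv (w : Site 3) : Site 3 :=
  ![(2 * w 0 - w 1 + 2 * w 2 + (w 0 + w 1 + w 2) % 3) / 3,
    (2 * w 0 + 2 * w 1 - w 2 + (w 0 + w 1 + w 2) % 3) / 3,
    (-w 0 + 2 * w 1 + 2 * w 2 + (w 0 + w 1 + w 2) % 3) / 3]

/-! ## Lattice two-point inputs -/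

/-- **Two-point toolkit** (consequence of `TwoPointScaling`, i.e. of `DilationJoinings ∧ UniformRegularity` through
`BlockLimits`, and of the infrared lower bound `⟨σ₀σ_x⟩ ≥ c‖x‖⁻²`): for the block variance `V(L) = blockCov L 0` of the
critical `ℤ³` Ising model there are `L₀ ≥ 1` and `A ≥ 1` with (a) UPPER DOUBLING `V(2L) ≤ A V(L)` for `L ≥ L₀`
(`V(2m)/V(m) → 64 r₂`), and (b) SUPER-CUBIC GROWTH `V(ℓ) L^{7/2} ≤ A ℓ^{7/2} V(L)` for `L₀ ≤ ℓ ≤ L`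
(`V(2m) ≥ 15 V(m)` eventually, because `64 r₂ ≥ 16`: `r₂ = lim g(2m)/g(m) ≥ 1/4` by `g(m) ≥ c m⁻²`). -/
def TwoPointToolkit : Prop :=
  ∃ L₀ : ℕ, 1 ≤ L₀ ∧ ∃ A : ℝ, 1 ≤ A ∧
    (∀ L : ℕ, L₀ ≤ L → blockCov (2 * L) 0 ≤ A * blockCov L 0) ∧
    (∀ ℓ L : ℕ, L₀ ≤ ℓ → ℓ ≤ L →
      blockCov ℓ 0 * (L : ℝ) ^ (7 / 2 : ℝ) ≤ A * (ℓ : ℝ) ^ (7 / 2 : ℝ) * blockCov L 0)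

/-- **Ball sums are dominated by the block variance**: for every `c` there are `A, L₀` with
`L³ Σ_{‖z‖_∞ ≤ cL} ⟨σ₀σ_z⟩_{β_c} ≤ A V(L)` for `L ≥ L₀`. Verbatim the conclusion of the landed
`Cruxes.JoiningsTransfer.Sketch.stub_ballSumRatio` (Theorems/SynchronousCouplingJoiningsTransferBallSumRatio.lean). -/
def BallSums : Prop :=
  ∀ c : ℕ, ∃ A : ℝ, ∃ L₀ : ℕ, 1 ≤ L₀ ∧ ∀ L : ℕ, L₀ ≤ L →
    (L : ℝ) ^ 3 * ∑ z ∈ box 3 (c * L), criticalTwoPoint 3 z ≤ A * blockCov L 0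

/-! ## Lattice geometry of the tilted cells -/

/-- **Tilted-cell geometry** (pure lattice geometry of `A = 3T`). (1,2) `ψ⁻¹ ∘ ψ = id = ψ ∘ ψ⁻¹`;
(3) `|3ψ(x)ᵢ − (Ax)ᵢ| ≤ 2`; (4) every tilted cell of the window is the `ψ⁻¹`-image of its axis cell, (5) hence has
exactly `n³` points; (6) axis cells of one side at distinct indices are disjoint; (7) the axis cube `[s, 2s)³`,
`s = ⌊L/3⌋`, lies in the tilted cell `u = 0` of side `L`; (8) DECOMPOSITION: for `1 ≤ b'`, `3b' ≤ b`, `|uᵢ| ≤ m` there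
is an index set `I` inside the window `|vᵢ| ≤ 2b(m+1)` such that the axis `b'`-cells (resp. `3b'`-cells) at `v ∈ I` lie
in the tilted `b`-cell (resp. `3b`-cell) at `u`, the uncovered remainders have at most `30 b² b'` (resp. `810 b² b'`)
points (they sit within `5b'` of the boundary of the slab conditions, and `ψ` is injective), and `|I| b'³ ≤ b³`;
(9) two points of one tilted cell differ by `< 2n` in every coordinate (`AᵀA = 9`, row sums of `|A|` are `5`);
(10) membership: `x ∈ tiltCell n m u ↔ ψ x ∈ axisCell n u` on the window. -/
def TiltGeometry : Prop :=
  (∀ x : Site 3, psiInv (psi x) = x) ∧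
  (∀ w : Site 3, psi (psiInv w) = w) ∧
  (∀ (x : Site 3) (i : Fin 3), |3 * psi x i - A3.mulVec x i| ≤ 2) ∧
  (∀ (n m : ℕ) (u : Fin 3 → ℤ), (∀ i, |u i| ≤ m) → tiltCell n m u = (axisCell n u).image psiInv) ∧
  (∀ (n m : ℕ) (u : Fin 3 → ℤ), (∀ i, |u i| ≤ m) → (tiltCell n m u).card = n ^ 3) ∧
  (∀ (n : ℕ) (v w : Fin 3 → ℤ), 1 ≤ n → v ≠ w → Disjoint (axisCell n v) (axisCell n w)) ∧
  (∀ L m : ℕ, axisCell (L / 3) (fun _ => 1) ⊆ tiltCell L m 0) ∧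
  (∀ (b b' m : ℕ) (u : Fin 3 → ℤ), 1 ≤ b' → 3 * b' ≤ b → (∀ i, |u i| ≤ m) →
    ∃ I : Finset (Fin 3 → ℤ),
      (∀ v ∈ I, ∀ i, |v i| ≤ 2 * (b : ℤ) * ((m : ℤ) + 1)) ∧
      (∀ v ∈ I, axisCell b' v ⊆ tiltCell b m u) ∧
      (∀ v ∈ I, axisCell (3 * b') v ⊆ tiltCell (3 * b) m u) ∧
      ((tiltCell b m u \ I.biUnion (axisCell b')).card ≤ 30 * b ^ 2 * b') ∧
      ((tiltCell (3 * b) m u \ I.biUnion (axisCell (3 * b'))).card ≤ 810 * b ^ 2 * b') ∧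
      ((I.card : ℝ) * (b' : ℝ) ^ 3 ≤ (b : ℝ) ^ 3)) ∧
  (∀ (n m : ℕ) (u : Fin 3 → ℤ) (x y : Site 3), x ∈ tiltCell n m u → y ∈ tiltCell n m u →
    ∀ i, |x i - y i| < 2 * (n : ℤ)) ∧
  (∀ (n m : ℕ) (u : Fin 3 → ℤ), (∀ i, |u i| ≤ m) → ∀ x : Site 3, x ∈ tiltCell n m u ↔ psi x ∈ axisCell n u)

/-! ## Probabilistic inputs -/

/-- **Newman's Gaussian bound for block spins** (Newman 1975; Aizenman–Duminil-Copin 2021 §6.3, lower inequality):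
for every critical DLR state `μ` on `ℤ³`, every finite set of sites `S` and every `k`,
`E_μ[(Σ_{x∈S} σ_x)^{2k}] ≤ (2k)!/(2ᵏ k!) · (E_μ[(Σ_{x∈S} σ_x)²])ᵏ` (expand, bound each `2k`-point function by the
pairing sum `criticalCorr_le_pairingSum`, re-sum). -/
def NewmanBlocks : Prop :=
  ∀ μ ∈ isingGibbsMeasures 3 (criticalBeta 3) 0, ∀ (S : Finset (Site 3)) (k : ℕ),
    ∫ σ, (blockSum S σ) ^ (2 * k) ∂μ ≤
      ((2 * k).factorial : ℝ) / (2 ^ k * k.factorial) * (∫ σ, (blockSum S σ) ^ 2 ∂μ) ^ k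

/-- **Method of moments, difference form** (Billingsley, *Convergence of Probability Measures*, Thm 5.1 and the
moment/characteristic-function uniqueness of §30): two sequences of bounded `ℝʲ`-valued random vectors with uniformly
sub-Gaussian coordinate moments `E[X_i^{2k}] ≤ (K k)^k` whose mixed moments are asymptotically equal have asymptotically
equal expectations of every bounded continuous test function (tightness from second moments; along subsequences both
laws converge by Prokhorov; the limits have equal, absolutely convergent exponential moment series, hence equal
characteristic functions, hence coincide). Pure probability. -/
def MomentsToTests : Prop :=
  ∀ (Ω : Type) [MeasurableSpace Ω] (P : Measure Ω) [IsProbabilityMeasure P] (j : ℕ)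
    (X Y : ℕ → Ω → (Fin j → ℝ)),
    (∀ n, Measurable (X n)) → (∀ n, Measurable (Y n)) →
    (∀ n, ∃ B : ℝ, ∀ ω i, |X n ω i| ≤ B ∧ |Y n ω i| ≤ B) →
    (∃ K : ℝ, ∀ (n : ℕ) (i : Fin j) (k : ℕ),
      ∫ ω, (X n ω i) ^ (2 * k) ∂P ≤ (K * k) ^ k ∧ ∫ ω, (Y n ω i) ^ (2 * k) ∂P ≤ (K * k) ^ k) →
    (∀ e : Fin j → ℕ,
      Tendsto (fun n => (∫ ω, ∏ i, (X n ω i) ^ (e i) ∂P) - ∫ ω, ∏ i, (Y n ω i) ^ (e i) ∂P) atTop (𝓝 0)) →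
    ∀ f : (Fin j → ℝ) → ℝ, Continuous f → (∃ B : ℝ, ∀ v, |f v| ≤ B) →
      Tendsto (fun n => (∫ ω, f (X n ω) ∂P) - ∫ ω, f (Y n ω) ∂P) atTop (𝓝 0)

/-! ## The two transfers and the route inputs -/

/-- **Tilted dilation joinings from axis dilation joinings** (reshape 2, stub T): the two-point toolkit, the tilted
geometry and the ball-sum bound transport the route's crux `DilationJoinings` (item 18762) to `DilationJoiningsTilted`. -/
def TiltedTransfer : Prop :=
  TwoPointToolkit → TiltGeometry → BallSums → SynchronousCoupling.DilationJoinings → DilationJoiningsTilted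

/-- **FDD isotropy from the route's cruxes** (reshape 2, stub F): the lattice inputs, Newman's bound and the method
of moments transport `DilationJoinings ∧ UniformRegularity` (items 18762, 4658) — through the tree's pinned scaling limit
and its rotation invariance — to `AsymptoticFDDIsotropy`. -/
def IsotropyTransfer : Prop :=
  TwoPointToolkit → TiltGeometry → BallSums → NewmanBlocks → MomentsToTests →
    SynchronousCoupling.DilationJoinings → SynchronousCoupling.UniformRegularity → AsymptoticFDDIsotropy

/-- **The route inputs of the line**: the two OPEN cruxes of route `SynchronousCoupling` consumed by reshape 2, items
stmt-CriticalPhenomena-18762 (`DilationJoinings`) and stmt-CriticalPhenomena-4658 (`UniformRegularity`) verbatim. Not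
worked in this line; the crux `RotationJoining` closes MODULO them. -/
def RouteCruxes : Prop :=
  SynchronousCoupling.DilationJoinings ∧ SynchronousCoupling.UniformRegularity

/-! ## Registered stub statements of reshape 2 (skeleton `Cruxes/RotationJoining/Lines/SketchIdeator2.lean`)

`RotationJoining_of : Sig.stub_routeCruxes → Sig.stub_twoPointToolkit → Sig.stub_tiltGeometry →
Sig.stub_tiltedTransfer → Sig.stub_momentsToTests → Sig.stub_newmanBlocks → Sig.stub_isotropyTransfer → RotationJoining`
(glue: `BallSums` from the landed `stub_ballSumRatio`, then the landed `stub_axis3OfDilationJoinings`,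
`stub_qualitativeOfFDDIsotropy`, `stub_rateBootstrap`). -/

/-- Stub 1 of reshape 2 (= `RouteCruxes`, items 18762 ∧ 4658; not worked in the line). -/
def Sig.stub_routeCruxes : Prop := RouteCruxes

/-- Stub 2 of reshape 2: the two-point toolkit from the route's cruxes (via `TwoPointScaling`). -/
def Sig.stub_twoPointToolkit : Prop :=
  SynchronousCoupling.DilationJoinings → SynchronousCoupling.UniformRegularity → TwoPointToolkit

/-- Stub 3 of reshape 2 (= `TiltGeometry`). -/
def Sig.stub_tiltGeometry : Prop := TiltGeometry

/-- Stub 4 of reshape 2 (= `TiltedTransfer`). -/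
def Sig.stub_tiltedTransfer : Prop := TiltedTransfer

/-- Stub 5 of reshape 2 (= `MomentsToTests`). -/
def Sig.stub_momentsToTests : Prop := MomentsToTests

/-- Stub 6 of reshape 2 (= `NewmanBlocks`). -/
def Sig.stub_newmanBlocks : Prop := NewmanBlocks

/-- Stub 7 of reshape 2 (= `IsotropyTransfer`; the lead's stub). -/
def Sig.stub_isotropyTransfer : Prop := IsotropyTransfer

/-- Certificate of the reshape (registered glue sub-goal `reshape2_routeCruxes_iff`): the route-inputs stub is, by
`Iff.rfl`, the conjunction of items stmt-18762 and stmt-4658. [folklore] -/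
theorem reshape2_routeCruxes_iff :
    Sig.stub_routeCruxes ↔ (SynchronousCoupling.DilationJoinings ∧ SynchronousCoupling.UniformRegularity) :=
  Iff.rfl

end Summit.CriticalPhenomena.Ising3DConformalLimit.Cruxes.RotationJoining.RateSplitting

end
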